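import Summits.NavierStokesRegularity.NavierStokesRegularity.Theses.PalasekTowerBreakdown
import Summits.NavierStokesRegularity.FluidComputer.PalasekTowerRegisterWindow

/-!
# NavierStokesRegularity — route `PalasekTowerBreakdown`: the ∀ of `EpisodeInduction` ranges over a NONEMPTY class (carrier term)

Supports `stmt-NavierStokesRegularity-19178` (`EpisodeInduction` = K2G `EpisodeInductionG`; it does NOT close it). Cell
`ns-blowup`, seat `ns-blowup-ecbridge-4` (g2), tribunal J feedback (b) for the route (planner STATUS 2026-08-26 05:18Z /
05:24Z): the hypothesis class of the crux's `∀ S` — pinned (`Λ = 8`, `θ = 6/5`), RIGID, QUIET schedules on the wide-base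
rates — is inhabited by a closed term of the tree, the zero-datum zero-force registered schedule of
`TowerRates.exists_registered_schedule` (PalasekTowerRegisterWindow, p410278: `Pins 8 (6/5) ∧ Rigid ∧ f ≡ 0`), whose
vanishing force is quiet in the strongest form (`Schedule.Quiet.of_force_eq_zero`). So K2G is not vacuous by an empty
schedule class; its binder `s : Stage …` (a registered stage at level `k ≥ 1`) is open by design (`RungG k`).
WHAT THIS IS NOT: not NS — rate/clock arithmetic on an explicit schedule; no stage, flow or tower is constructed.
-/

-- `Summit.<Summit>.<Problem>` is the tree's mandated summit-side namespace (CONVENTIONS §2); for this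
-- single-conjunct summit the two coincide, so the duplicate is deliberate.
set_option linter.dupNamespace false

namespace Summit.NavierStokesRegularity.NavierStokesRegularity.Theorems

open Summit.NavierStokesRegularity.NavierStokesRegularity.Theses
open Summit.NavierStokesRegularity.FluidComputer.PalasekTowerClayBridge

/-- **Carrier term for the `∀ S` of `EpisodeInduction`**: there is a pinned (`Λ = 8`, `θ = 6/5`), rigid, quiet schedule
on the wide-base rates (the registered zero schedule; quiet because its force vanishes identically). [folklore] -/
theorem palasekTowerBreakdown_exists_pinned_rigid_quiet_schedule :
    ∃ S : Schedule TowerRates.wide, S.Pins 8 (6 / 5) ∧ S.Rigid ∧ S.Quiet := by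
  obtain ⟨S, hP, hR, hf⟩ := TowerRates.exists_registered_schedule
  exact ⟨S, hP, hR, Schedule.Quiet.of_force_eq_zero hf⟩

/-- The same, read against the route: the hypotheses `S.Pins 8 (6/5) → S.Rigid → S.Quiet →` of the crux
`EpisodeInduction` (= `EpisodeInductionG`) are jointly satisfiable, so the item is a statement about the stages of
such schedules, not a vacuity. [folklore] -/
theorem palasekTowerBreakdown_episodeInduction_hypotheses_nonempty :
    ∃ S : Schedule TowerRates.wide, S.Pins 8 (6 / 5) ∧ S.Rigid ∧ S.Quiet ∧
      (PalasekTowerBreakdown.EpisodeInduction →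
        ∀ k : ℕ, 1 ≤ k → ∀ s : Stage 1 TowerRates.wide S (Margins.routeG TowerRates.wide) k,
          ∃ s' : Stage 1 TowerRates.wide S (Margins.routeG TowerRates.wide) (k + 1), s.Extends s') := by
  obtain ⟨S, hP, hR, hQ⟩ := palasekTowerBreakdown_exists_pinned_rigid_quiet_schedule
  refine ⟨S, hP, hR, hQ, fun h k hk s => ?_⟩
  unfold PalasekTowerBreakdown.EpisodeInduction at h
  exact h S hP hR hQ k hk s

end Summit.NavierStokesRegularity.NavierStokesRegularity.Theorems
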